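import Summits.AtomisticToContinuum.Crystallization.Theses.NashClassCertificates
import Summits.AtomisticToContinuum.Crystallization.Theorems.CoerciveTwoShellGap.Negative.Tolerance
import Summits.AtomisticToContinuum.Crystallization.Theorems.NashClassCertificatesNashTwoShellGapNashSeparation
import Summits.AtomisticToContinuum.Crystallization.Theorems.HullMinimalityLayeredWindowsGroundStatesAreNash

/-!
# `NashTwoShellGap` (stmt-AtomisticToContinuum-16826), negative side I: shape of the crux on the Nash class

Crux (route `NashClassCertificates`, rank 2): `∃ g > 0, ∀ N (x : Fin N → ℝ³), x 1/3-separated →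
x NASH for V_LJ → N·e* + g·#{i : ¬ IsTwoShellGood (1/20) (47/50) 1 x i} ≤ 𝓔_LJ(x)`, `e* = ⨅_Q e_LJ(Q)`,
NASH being the best-response clause `∀ i, ∀ y ∉ {x j : j ≠ i}, siteEnergy x i ≤ ∑_{j ≠ i} V_LJ(|y − x_j|)`.
Refuter (cdisprove seat, cycle 1); no definition is introduced — statements are spelled out with the
tree's `eStar`, `E3`.  Findings, as kernel-checked theorems:
* §1 NON-VACUITY / CERTIFIED TIGHTNESS OF `g`: all-unit-distance configurations are Nash
  (`nash_of_forall_dist_eq_one`); the regular unit tetrahedron exists, is `1`-separated, all-bad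
  (`4 ≤ 18`) and has energy `−1/2`, so every admissible `g` has `g ≤ −1/8 − e*` (`g_le_of_nashGap`)
  and `g ≤ −e*` (singleton); the crux forces `e* < −1/8` while the tree gives `e* ≤ −1/8`
  (`eStar_le_neg_one_eighth`).  Certified tightness stops at the simplex (a non-unit distance needs a
  global Nash certificate over `y ∈ ℝ³`, and a number needs `e*` from below); numerically
  `−1/8 − e* ≈ 0.593` against an uncertified optimum `g_opt ≈ 4–5·10⁻³` (bent closed rings of good
  crystal, `Cruxes/NashTwoShellGap/BarrierNotesIdeator2.md` §B5).
* §2 SEPARATION = INJECTIVITY ON THE NASH CLASS: Nash + injective ⇒ `1/3`-separated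
  (`third_le_dist_of_nash`), so the crux is equivalent to its injective form
  (`nashTwoShellGap_iff_injectiveForm`) and every ground state lies in the class
  (`isGroundState_mem_class`).  Injectivity is load-bearing only through the junk value `V_LJ(0) = 0`
  (junk-Nash piles, `Cruxes/NashTwoShellGap/Disproof.lean` §3, uncertified).
* §3 KILL TEMPLATE: ground states are in the class with `E(N)/N → e*`, so any price charging ground
  states linearly in `N` is refuted for every `g > 0` without knowing `e*`
  (`false_of_linear_charge_on_groundStates`): the crux is false iff-ish ground states carry a bad
  fraction (`not_nashTwoShellGap_of_groundStates_bad`; contrapositive `bad_lt_of_nashTwoShellGap` —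
  exactly what `closes` consumes), and the tolerance sign is load-bearing (`not_tol_of_neg`, `tol_mono`;
  the `ε = 0` boundary, refuted for the parent 13956 by generic perturbation, is OPEN on the Nash class).
* §4 THE LINE `birth` IS A PARTITION: `exposedBadGap_of_nashTwoShellGap` (and the landed
  `jammedBadGap_of_nashTwoShellGap`): no stub is refutable short of refuting the crux.
All `[folklore]`.
-/

noncomputable section

namespace Summit.AtomisticToContinuum.Crystallization.Theorems.NashTwoShellGapNegative

open scoped BigOperators Classical
open Literature.MathematicalPhysics.StatisticalMechanics Literature.Geometry.DiscreteGeometry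
open Summit.AtomisticToContinuum.Crystallization.Theorems.ChargedEnergyGapNegative
open Summit.AtomisticToContinuum.Crystallization.Theorems.CoerciveTwoShellGapNegative
open Summit.AtomisticToContinuum.Crystallization.Theorems.NashTwoShellGapNashSeparation
open Summit.AtomisticToContinuum.Crystallization.Theorems.LayeredWindowsLocal
open Summit.AtomisticToContinuum.Crystallization.Theses.NashClassCertificates

/-! ## §0 Read-back -/

/-- The crux, definitionally, with the tree's abbreviation `eStar = ⨅_Q e_LJ(Q)`. [folklore] -/
theorem nashTwoShellGap_iff :
    NashTwoShellGap ↔ ∃ g : ℝ, 0 < g ∧ ∀ (N : ℕ) (x : Fin N → E3),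
      (∀ i j : Fin N, i ≠ j → (1 / 3 : ℝ) ≤ dist (x i) (x j)) →
      (∀ (i : Fin N) (y : E3), (∀ j : Fin N, j ≠ i → y ≠ x j) →
        siteEnergy lennardJones x i ≤ ∑ j ∈ Finset.univ.erase i, lennardJones (dist y (x j))) →
      (N : ℝ) * eStar + g * (Nat.card {i : Fin N // ¬ IsTwoShellGood (1 / 20) (47 / 50) 1 x i} : ℝ)
        ≤ interactionEnergy lennardJones x :=
  Iff.rfl

/-- `1/3`-separated configurations are injective. [folklore] -/
theorem injective_of_third_sep {N : ℕ} {x : Fin N → E3}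
    (h : ∀ i j : Fin N, i ≠ j → (1 / 3 : ℝ) ≤ dist (x i) (x j)) : Function.Injective x := by
  intro i j hij
  by_contra hne
  have := h i j hne
  rw [hij, dist_self] at this
  linarith

/-- **The `g = 0` skeleton is free on the class** (indeed for every `1/3`-separated `x`, Nash or
not): `N·e* ≤ 𝓔(x)` (tree: periodisation + `BddBelow`).  All content of the crux is `0 < g`.
[folklore] -/
theorem nashGap_zero {N : ℕ} {x : Fin N → E3}
    (hx : ∀ i j : Fin N, i ≠ j → (1 / 3 : ℝ) ≤ dist (x i) (x j)) :
    (N : ℝ) * eStar ≤ interactionEnergy lennardJones x :=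
  card_mul_eStar_le (injective_of_third_sep hx)

/-! ## §1 Unit-distance clusters are Nash: non-vacuity and the certified tightness of `g` -/

/-- **A configuration with all mutual distances equal to `1` is Nash**: each site sum is
`−(N−1)/12`, and every hole potential is `≥ −(N−1)/12` termwise (`V_LJ ≥ −1/12`).  Singleton, unit
dimer, unit triangle and unit tetrahedron are the instances in `ℝ³`. [folklore] -/
theorem nash_of_forall_dist_eq_one {N : ℕ} {x : Fin N → E3}
    (h : ∀ i j : Fin N, i ≠ j → dist (x i) (x j) = 1) (i : Fin N) (y : E3) :
    siteEnergy lennardJones x i ≤ ∑ j ∈ Finset.univ.erase i, lennardJones (dist y (x j)) := by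
  unfold siteEnergy
  refine Finset.sum_le_sum fun k hk => ?_
  rw [h i k (Finset.ne_of_mem_erase hk).symm, lennardJones_one]
  exact neg_one_div_le_lennardJones _

/-- Site sums of an all-unit-distance configuration: `−(N−1)/12`. [folklore] -/
theorem siteEnergy_of_forall_dist_eq_one {N : ℕ} {x : Fin N → E3}
    (h : ∀ i j : Fin N, i ≠ j → dist (x i) (x j) = 1) (i : Fin N) :
    siteEnergy lennardJones x i = -(((N : ℝ) - 1) / 12) := by
  unfold siteEnergy
  rw [Finset.sum_congr rfl fun k hk => by
    rw [h i k (Finset.ne_of_mem_erase hk).symm, lennardJones_one]]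
  rw [Finset.sum_const, Finset.card_erase_of_mem (Finset.mem_univ i), Finset.card_univ,
    Fintype.card_fin, nsmul_eq_mul, Nat.cast_sub (Fin.pos i)]
  push_cast
  ring

/-- Energy of an all-unit-distance configuration: `−N(N−1)/24`. [folklore] -/
theorem interactionEnergy_of_forall_dist_eq_one {N : ℕ} {x : Fin N → E3}
    (h : ∀ i j : Fin N, i ≠ j → dist (x i) (x j) = 1) :
    interactionEnergy lennardJones x = -((N : ℝ) * ((N : ℝ) - 1) / 24) := by
  have h2 := two_mul_interactionEnergy lennardJones x
  rw [Finset.sum_congr rfl fun i _ => siteEnergy_of_forall_dist_eq_one h i, Finset.sum_const,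
    Finset.card_univ, Fintype.card_fin, nsmul_eq_mul] at h2
  linear_combination (1 / 2 : ℝ) * h2

/-- An all-unit-distance configuration is injective and `1/3`-separated. [folklore] -/
theorem third_le_dist_of_forall_dist_eq_one {N : ℕ} {x : Fin N → E3}
    (h : ∀ i j : Fin N, i ≠ j → dist (x i) (x j) = 1) :
    ∀ i j : Fin N, i ≠ j → (1 / 3 : ℝ) ≤ dist (x i) (x j) := fun i j hij => by
  rw [h i j hij]; norm_num

/-- **The regular unit tetrahedron exists in `ℝ³`** (alternate vertices of the cube of side `1/√2`).
[folklore] -/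
theorem exists_unit_tetrahedron :
    ∃ x : Fin 4 → E3, ∀ i j : Fin 4, i ≠ j → dist (x i) (x j) = 1 := by
  set s : ℝ := Real.sqrt (1 / 2) with hs
  have hs2 : s ^ 2 = 1 / 2 := Real.sq_sqrt (by norm_num)
  refine ⟨![!₂[0, 0, 0], !₂[s, s, 0], !₂[s, 0, s], !₂[0, s, s]], ?_⟩
  intro i j hij
  fin_cases i <;> fin_cases j <;>
    first
    | exact absurd rfl hij
    | (rw [EuclideanSpace.dist_eq, Real.sqrt_eq_one, Fin.sum_univ_three]
       simp [hs2]
       norm_num)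

/-- **Tightness, one particle**: every admissible `g` has `g ≤ −e*` (the singleton is Nash, bad, and
has energy `0`). [folklore] -/
theorem g_le_neg_eStar_of_nashGap {g : ℝ}
    (hG : ∀ (N : ℕ) (x : Fin N → E3),
      (∀ i j : Fin N, i ≠ j → (1 / 3 : ℝ) ≤ dist (x i) (x j)) →
      (∀ (i : Fin N) (y : E3), (∀ j : Fin N, j ≠ i → y ≠ x j) →
        siteEnergy lennardJones x i ≤ ∑ j ∈ Finset.univ.erase i, lennardJones (dist y (x j))) →
      (N : ℝ) * eStar + g * (Nat.card {i : Fin N // ¬ IsTwoShellGood (1 / 20) (47 / 50) 1 x i} : ℝ)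
        ≤ interactionEnergy lennardJones x) :
    g ≤ -eStar := by
  have hd : ∀ i j : Fin 1, i ≠ j → dist ((fun _ => (0 : E3)) i) ((fun _ => (0 : E3)) j) = 1 :=
    fun i j hij => absurd (Subsingleton.elim i j) hij
  have h1 := hG 1 (fun _ => 0) (third_le_dist_of_forall_dist_eq_one hd)
    (fun i y _ => nash_of_forall_dist_eq_one hd i y)
  rw [bad_eq_of_le (1 / 20) (N := 1) (by norm_num) (fun _ => 0), interactionEnergy_of_subsingleton]
    at h1
  push_cast at h1
  linarith

/-- **Tightness, the tetrahedron**: every admissible `g` has `g ≤ −1/8 − e*` (the regular unit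
tetrahedron is `1`-separated, Nash, all-bad since `4 ≤ 18`, with energy `6·V_LJ(1) = −1/2`).  This is
the end of the certified road: a cluster with a non-unit distance needs a global Nash certificate, and
a numerical value needs `e*` from below. [folklore] -/
theorem g_le_of_nashGap {g : ℝ}
    (hG : ∀ (N : ℕ) (x : Fin N → E3),
      (∀ i j : Fin N, i ≠ j → (1 / 3 : ℝ) ≤ dist (x i) (x j)) →
      (∀ (i : Fin N) (y : E3), (∀ j : Fin N, j ≠ i → y ≠ x j) →
        siteEnergy lennardJones x i ≤ ∑ j ∈ Finset.univ.erase i, lennardJones (dist y (x j))) →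
      (N : ℝ) * eStar + g * (Nat.card {i : Fin N // ¬ IsTwoShellGood (1 / 20) (47 / 50) 1 x i} : ℝ)
        ≤ interactionEnergy lennardJones x) :
    g ≤ -1 / 8 - eStar := by
  obtain ⟨x, hx⟩ := exists_unit_tetrahedron
  have h1 := hG 4 x (third_le_dist_of_forall_dist_eq_one hx) (fun i y _ => nash_of_forall_dist_eq_one hx i y)
  rw [bad_eq_of_le (1 / 20) (N := 4) (by norm_num) x, interactionEnergy_of_forall_dist_eq_one hx] at h1
  push_cast at h1
  linarith

/-- **`e* ≤ −1/8` unconditionally** (periodise the unit tetrahedron: `4·e* ≤ 𝓔 = −1/2`; improves the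
tree's `−1/24` from the dimer). [folklore] -/
theorem eStar_le_neg_one_eighth : eStar ≤ -1 / 8 := by
  obtain ⟨x, hx⟩ := exists_unit_tetrahedron
  have h1 := card_mul_eStar_le (injective_of_third_sep (third_le_dist_of_forall_dist_eq_one hx))
  rw [interactionEnergy_of_forall_dist_eq_one hx] at h1
  push_cast at h1
  linarith

/-- Hence the crux forces the strict inequality `e* < −1/8` (consistent, and numerically idle:
`e* ≈ −0.7176`). [folklore] -/
theorem eStar_lt_of_nashTwoShellGap (h : NashTwoShellGap) : eStar < -1 / 8 := by
  obtain ⟨g, hg, hG⟩ := h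
  have := g_le_of_nashGap hG
  linarith

/-! ## §2 Separation is injectivity on the Nash class -/

/-- **Nash + distinct points ⇒ `1/3`-separated** (the tree's closest-pair argument for ground
states, run with the removal inequality `siteEnergy ≤ 0` of the Nash class,
`siteEnergy_nonpos_of_nash`): at a closest pair at distance `r < 1/3`, `0 ≥ r⁻¹²/12 − (250/6)r⁻⁶`
contradicts `r⁻⁶ > 729`. [folklore] -/
theorem third_le_dist_of_nash {N : ℕ} {x : Fin N → E3} (hx : Function.Injective x)
    (hN : ∀ (i : Fin N) (y : E3), (∀ j : Fin N, j ≠ i → y ≠ x j) →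
      siteEnergy lennardJones x i ≤ ∑ j ∈ Finset.univ.erase i, lennardJones (dist y (x j)))
    {i j : Fin N} (hij : i ≠ j) : (1 / 3 : ℝ) ≤ dist (x i) (x j) := by
  by_contra hlt
  rw [not_le] at hlt
  obtain ⟨p, hp, hmin⟩ := Finset.exists_min_image Finset.univ.offDiag
    (fun p : Fin N × Fin N => dist (x p.1) (x p.2)) ⟨(i, j), by simp [hij]⟩
  obtain ⟨i₀, j₀⟩ := p
  have hij₀ : i₀ ≠ j₀ := by simpa using hp
  set r := dist (x i₀) (x j₀) with hr_def
  have hr : 0 < r := dist_pos.2 (hx.ne hij₀)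
  have hsep : ∀ k l, k ≠ l → r ≤ dist (x k) (x l) := fun k l hkl => hmin (k, l) (by simp [hkl])
  have hr3 : r < 1 / 3 := (hsep i j hij).trans_lt hlt
  have h0 := siteEnergy_nonpos_of_nash x i₀ (hN i₀)
  have hS := sum_inv_pow_six_le x hr hsep i₀
  have h12 : r⁻¹ ^ 12 ≤ ∑ k ∈ Finset.univ.erase i₀, (dist (x i₀) (x k))⁻¹ ^ 12 := by
    have hj : j₀ ∈ Finset.univ.erase i₀ := Finset.mem_erase.2 ⟨hij₀.symm, Finset.mem_univ _⟩
    exact Finset.single_le_sum (f := fun k => (dist (x i₀) (x k))⁻¹ ^ 12)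
      (fun k _ => by positivity) hj
  have hexp : siteEnergy lennardJones x i₀ =
      (1 / 12) * ∑ k ∈ Finset.univ.erase i₀, (dist (x i₀) (x k))⁻¹ ^ 12 -
        (1 / 6) * ∑ k ∈ Finset.univ.erase i₀, (dist (x i₀) (x k))⁻¹ ^ 6 := by
    simp only [siteEnergy, lennardJones, Finset.sum_sub_distrib, Finset.mul_sum]
  have hu : (729 : ℝ) < r⁻¹ ^ 6 := by
    have h3 : 3 < r⁻¹ := by
      rw [lt_inv_comm₀ (by norm_num) hr]
      have : (3 : ℝ)⁻¹ = 1 / 3 := by norm_num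
      linarith
    calc (729 : ℝ) = 3 ^ 6 := by norm_num
      _ < r⁻¹ ^ 6 := pow_lt_pow_left₀ h3 (by norm_num) (by norm_num)
  have h12' : r⁻¹ ^ 12 = (r⁻¹ ^ 6) ^ 2 := by ring
  have hu' : 729 * r⁻¹ ^ 6 < r⁻¹ ^ 6 * r⁻¹ ^ 6 := mul_lt_mul_of_pos_right hu (by linarith)
  rw [h12', sq] at h12
  linarith

/-- **The crux is equivalent to its injective form**: the hypothesis `1/3`-separated may be replaced
by `Function.Injective x` (same `g`).  So `h_sep` is exactly "distinct points"; what cannot be dropped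
is injectivity, and only because of the junk value `V_LJ(0) = 0`. [folklore] -/
theorem nashTwoShellGap_iff_injectiveForm :
    NashTwoShellGap ↔ ∃ g : ℝ, 0 < g ∧ ∀ (N : ℕ) (x : Fin N → E3), Function.Injective x →
      (∀ (i : Fin N) (y : E3), (∀ j : Fin N, j ≠ i → y ≠ x j) →
        siteEnergy lennardJones x i ≤ ∑ j ∈ Finset.univ.erase i, lennardJones (dist y (x j))) →
      (N : ℝ) * eStar + g * (Nat.card {i : Fin N // ¬ IsTwoShellGood (1 / 20) (47 / 50) 1 x i} : ℝ)
        ≤ interactionEnergy lennardJones x := by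
  constructor
  · rintro ⟨g, hg, hG⟩
    exact ⟨g, hg, fun N x hx hN => hG N x (fun i j hij => third_le_dist_of_nash hx hN hij) hN⟩
  · rintro ⟨g, hg, hG⟩
    exact ⟨g, hg, fun N x hsep hN => hG N x (injective_of_third_sep hsep) hN⟩

/-- **Every Lennard-Jones ground state lies in the class**: injective, Nash (the landed one-particle
move `siteEnergy_le_sum_of_isGroundState`) and therefore `1/3`-separated. [folklore] -/
theorem isGroundState_mem_class {N : ℕ} {x : Fin N → E3} (hx : IsGroundState lennardJones x) :
    Function.Injective x ∧
    (∀ (i : Fin N) (y : E3), (∀ j : Fin N, j ≠ i → y ≠ x j) →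
        siteEnergy lennardJones x i ≤ ∑ j ∈ Finset.univ.erase i, lennardJones (dist y (x j))) ∧
    (∀ i j : Fin N, i ≠ j → (1 / 3 : ℝ) ≤ dist (x i) (x j)) := by
  have hN : ∀ (i : Fin N) (y : E3), (∀ j : Fin N, j ≠ i → y ≠ x j) →
      siteEnergy lennardJones x i ≤ ∑ j ∈ Finset.univ.erase i, lennardJones (dist y (x j)) :=
    fun i y hy => siteEnergy_le_sum_of_isGroundState hx i hy
  exact ⟨hx.1, hN, fun i j hij => third_le_dist_of_nash hx.1 hN hij⟩

/-! ## §3 The kill template: nothing may charge ground states linearly -/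

/-- **No price charges ground states linearly.**  If a count `B` satisfies `B(x) ≥ c·N` on ground
states of arbitrarily large size (`c > 0`), then `N·e* + g·B(x) ≤ 𝓔(x)` fails on some ground state
for every `g > 0` — because `𝓔(x_N) = E(N)` and `E(N)/N → e*` (tree).  No knowledge of the value of
`e*` is needed; this is the only `e*`-free refutation mechanism available for this crux. [folklore] -/
theorem false_of_linear_charge_on_groundStates {g c : ℝ} (hg : 0 < g) (hc : 0 < c)
    (B : (N : ℕ) → (Fin N → E3) → ℝ)
    (hB : ∀ N₀ : ℕ, ∃ N : ℕ, N₀ ≤ N ∧ ∃ x : Fin N → E3, IsGroundState lennardJones x ∧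
      c * N ≤ B N x)
    (hG : ∀ (N : ℕ) (x : Fin N → E3), IsGroundState lennardJones x →
      (N : ℝ) * eStar + g * B N x ≤ interactionEnergy lennardJones x) : False := by
  have hlim : Filter.Tendsto (fun N : ℕ => groundStateEnergy lennardJones 3 N / N) Filter.atTop
      (nhds eStar) := crysEnergyLimit
  have hev : ∀ᶠ N : ℕ in Filter.atTop, groundStateEnergy lennardJones 3 N / N < eStar + g * c :=
    hlim.eventually (gt_mem_nhds (by nlinarith))
  obtain ⟨N₀, hN₀⟩ := Filter.eventually_atTop.1 (hev.and (Filter.eventually_ge_atTop 1))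
  obtain ⟨N, hNN₀, x, hx, hcN⟩ := hB N₀
  obtain ⟨hlt, hN1⟩ := hN₀ N hNN₀
  have hNr : (0 : ℝ) < N := by exact_mod_cast hN1
  have h1 := hG N x hx
  rw [hx.2] at h1
  rw [div_lt_iff₀ hNr] at hlt
  nlinarith

/-- **KILL TEMPLATE.**  If along a subsequence the Lennard-Jones ground states carry a positive
fraction of `1/20`-bad particles, the crux is false (whatever `e*` is).  A refutation by an explicit
non-minimising Nash family would in addition have to certify `e*` from below to the precision of the
family's excess per particle — impossible with the tree's bounds — so this template is, today, the
only road to `¬ NashTwoShellGap`; its hypothesis is the failure of two-shell crystallization of ground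
states, which nobody can exhibit either.  This is why the crux resists disproof. [folklore] -/
theorem not_nashTwoShellGap_of_groundStates_bad
    (hbad : ∃ c : ℝ, 0 < c ∧ ∀ N₀ : ℕ, ∃ N : ℕ, N₀ ≤ N ∧ ∃ x : Fin N → E3,
      IsGroundState lennardJones x ∧
      c * N ≤ (Nat.card {i : Fin N // ¬ IsTwoShellGood (1 / 20) (47 / 50) 1 x i} : ℝ)) :
    ¬ NashTwoShellGap := by
  rintro ⟨g, hg, hG⟩
  obtain ⟨c, hc, hfreq⟩ := hbad
  refine false_of_linear_charge_on_groundStates hg hc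
    (fun N x => (Nat.card {i : Fin N // ¬ IsTwoShellGood (1 / 20) (47 / 50) 1 x i} : ℝ)) hfreq
    fun N x hx => ?_
  obtain ⟨-, hN, hsep⟩ := isGroundState_mem_class hx
  exact hG N x hsep hN

/-- **Contrapositive, for the provers**: the crux PREDICTS that ground states have `o(N)` bad
particles — for every `c > 0`, eventually in `N`, every ground state has `< c·N` bad particles.  This
(and only this) is what `NashHullBridge`/`closes` extract from the crux. [folklore] -/
theorem bad_lt_of_nashTwoShellGap (h : NashTwoShellGap) {c : ℝ} (hc : 0 < c) :
    ∃ N₀ : ℕ, ∀ N : ℕ, N₀ ≤ N → ∀ x : Fin N → E3, IsGroundState lennardJones x →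
      (Nat.card {i : Fin N // ¬ IsTwoShellGood (1 / 20) (47 / 50) 1 x i} : ℝ) < c * N := by
  by_contra hcon
  push Not at hcon
  exact not_nashTwoShellGap_of_groundStates_bad ⟨c, hc, hcon⟩ h

/-- At a negative tolerance nobody is good (a match within `ε·a < 0` is impossible). [folklore] -/
theorem not_isTwoShellGood_of_neg {ε aLo aHi : ℝ} (hε : ε < 0) (haLo : 0 < aLo) {N : ℕ}
    (x : Fin N → E3) (i : Fin N) : ¬ IsTwoShellGood ε aLo aHi x i := by
  rintro ⟨a, ha₁, -, A, P, f, hP, hf, -, -⟩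
  have hcard : P.card = 18 := card_eq_eighteen_of_twoShellPattern hP
  obtain ⟨v, hv⟩ : P.Nonempty := Finset.card_pos.1 (by omega)
  have h1 := (hf v hv).2
  have h2 : ε * a < 0 := mul_neg_of_neg_of_pos hε (haLo.trans_le ha₁)
  linarith [dist_nonneg (x := x (f v)) (y := x i + a • A v)]

/-- **The admissible tolerances form an up-set** (the crux is the `ε = 1/20` member of the family,
verbatim). [folklore] -/
theorem tol_mono {ε ε' : ℝ} (hε : ε ≤ ε')
    (h : ∃ g : ℝ, 0 < g ∧ ∀ (N : ℕ) (x : Fin N → E3),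
      (∀ i j : Fin N, i ≠ j → (1 / 3 : ℝ) ≤ dist (x i) (x j)) →
      (∀ (i : Fin N) (y : E3), (∀ j : Fin N, j ≠ i → y ≠ x j) →
        siteEnergy lennardJones x i ≤ ∑ j ∈ Finset.univ.erase i, lennardJones (dist y (x j))) →
      (N : ℝ) * eStar + g * (Nat.card {i : Fin N // ¬ IsTwoShellGood ε (47 / 50) 1 x i} : ℝ)
        ≤ interactionEnergy lennardJones x) :
    ∃ g : ℝ, 0 < g ∧ ∀ (N : ℕ) (x : Fin N → E3),
      (∀ i j : Fin N, i ≠ j → (1 / 3 : ℝ) ≤ dist (x i) (x j)) →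
      (∀ (i : Fin N) (y : E3), (∀ j : Fin N, j ≠ i → y ≠ x j) →
        siteEnergy lennardJones x i ≤ ∑ j ∈ Finset.univ.erase i, lennardJones (dist y (x j))) →
      (N : ℝ) * eStar + g * (Nat.card {i : Fin N // ¬ IsTwoShellGood ε' (47 / 50) 1 x i} : ℝ)
        ≤ interactionEnergy lennardJones x := by
  obtain ⟨g, hg, hG⟩ := h
  refine ⟨g, hg, fun N x hsep hN => le_trans ?_ (hG N x hsep hN)⟩
  have : (Nat.card {i : Fin N // ¬ IsTwoShellGood ε' (47 / 50) 1 x i} : ℝ) ≤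
      Nat.card {i : Fin N // ¬ IsTwoShellGood ε (47 / 50) 1 x i} := by exact_mod_cast bad_anti hε x
  nlinarith

/-- **The tolerance sign is load-bearing**: with `ε < 0` in place of `1/20` the statement is false on
the Nash class (every ground state is all-bad and `E(N)/N → e*`).  The boundary case `ε = 0`, refuted
for the parent crux 13956 by generic perturbation, is OPEN on the Nash class. [folklore] -/
theorem not_tol_of_neg {ε : ℝ} (hε : ε < 0) :
    ¬ ∃ g : ℝ, 0 < g ∧ ∀ (N : ℕ) (x : Fin N → E3),
      (∀ i j : Fin N, i ≠ j → (1 / 3 : ℝ) ≤ dist (x i) (x j)) →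
      (∀ (i : Fin N) (y : E3), (∀ j : Fin N, j ≠ i → y ≠ x j) →
        siteEnergy lennardJones x i ≤ ∑ j ∈ Finset.univ.erase i, lennardJones (dist y (x j))) →
      (N : ℝ) * eStar + g * (Nat.card {i : Fin N // ¬ IsTwoShellGood ε (47 / 50) 1 x i} : ℝ)
        ≤ interactionEnergy lennardJones x := by
  rintro ⟨g, hg, hG⟩
  refine false_of_linear_charge_on_groundStates hg one_pos
    (fun N x => (Nat.card {i : Fin N // ¬ IsTwoShellGood ε (47 / 50) 1 x i} : ℝ))
    (fun N₀ => ⟨N₀, le_rfl, ?_⟩) fun N x hx => ?_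
  · obtain ⟨x, hx⟩ := LennardJonesGroundStatesExist_holds N₀
    refine ⟨x, hx, ?_⟩
    rw [bad_eq_of_forall ε fun i => not_isTwoShellGood_of_neg hε (by norm_num) x i, one_mul]
  · obtain ⟨-, hN, hsep⟩ := isGroundState_mem_class hx
    exact hG N x hsep hN

/-! ## §4 The picked line `birth` is a partition of the crux -/

/-- **The exposed-bad gap of line `birth` follows from the crux** (sub-count, and `1/2`-separated ⊂
`1/3`-separated); with `NashTwoShellGapReductions.jammedBadGap_of_nashTwoShellGap` both gap stubs are
consequences of the crux, so neither is refutable short of refuting the crux. [folklore] -/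
theorem exposedBadGap_of_nashTwoShellGap (h : NashTwoShellGap) :
    ∃ g : ℝ, 0 < g ∧ ∀ (N : ℕ) (x : Fin N → E3),
      (∀ i j : Fin N, i ≠ j → (1 / 2 : ℝ) ≤ dist (x i) (x j)) →
      (∀ (i : Fin N) (y : E3), (∀ j : Fin N, j ≠ i → y ≠ x j) →
        siteEnergy lennardJones x i ≤ ∑ j ∈ Finset.univ.erase i, lennardJones (dist y (x j))) →
      (N : ℝ) * eStar + g * (Nat.card {i : Fin N // ¬ IsTwoShellGood (1 / 20) (47 / 50) 1 x i ∧
          ∃ p : E3, dist p (x i) ≤ 6 / 5 ∧ ∀ j : Fin N, 9 / 10 ≤ dist p (x j)} : ℝ)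
        ≤ interactionEnergy lennardJones x := by
  obtain ⟨g, hg, hG⟩ := nashTwoShellGap_iff.1 h
  refine ⟨g, hg, fun N x hsep hN => le_trans ?_ (hG N x (fun i j hij => ?_) hN)⟩
  · have hle : Nat.card {i : Fin N // ¬ IsTwoShellGood (1 / 20) (47 / 50) 1 x i ∧
          ∃ p : E3, dist p (x i) ≤ 6 / 5 ∧ ∀ j : Fin N, 9 / 10 ≤ dist p (x j)} ≤
        Nat.card {i : Fin N // ¬ IsTwoShellGood (1 / 20) (47 / 50) 1 x i} :=
      Nat.card_mono (Set.toFinite _) fun i hi => hi.1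
    have : (Nat.card {i : Fin N // ¬ IsTwoShellGood (1 / 20) (47 / 50) 1 x i ∧
          ∃ p : E3, dist p (x i) ≤ 6 / 5 ∧ ∀ j : Fin N, 9 / 10 ≤ dist p (x j)} : ℝ) ≤
        Nat.card {i : Fin N // ¬ IsTwoShellGood (1 / 20) (47 / 50) 1 x i} := by exact_mod_cast hle
    nlinarith
  · linarith [hsep i j hij]

end Summit.AtomisticToContinuum.Crystallization.Theorems.NashTwoShellGapNegative

end
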